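import Literature.RepresentationTheory.GeneralLinear.WreathInsert
import HarnessLib

/-!
# Prepending a row of width `n`: `HW(Symⁿ/Λⁿ Λᵐ V')_μ ≅ HW(Symⁿ/Λⁿ Λ^{m+1} V)_{(n,μ)}`
# (Fischer–Ikenmeyer 2020, Fact 2 and Lemma 1, in the word model)

N. Fischer, C. Ikenmeyer, *The computational complexity of plethysm coefficients*, Comput.
Complexity 29 (2020) 8, §4: Lemma 1 ("Let `m` be fixed. Given a partition `λ` encoded in unary, we
can compute partitions `π` and `π'` in polynomial time so that `a_λ(n, m) = b_π(n, m + 1)` and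
`b_λ(n, m) = a_{π'}(n, m + 1)`") is proved from Fact 1 (`WreathHighestWeight.lean`) and Fact 2
([Manivel–Michałek 2015]: prepending a row of width `n` to `λ` does not change the multiplicity when
passing from `S^ν Λᵐ V` to `S^ν Λ^{m+1} V`).

This file proves the word-model form of Fact 2 for the outer functors `Symⁿ`, `Λⁿ` (the cases
`ν = (n)`, `(1ⁿ)` used by Lemma 1), in POSITIVITY form, which is what the NP-hardness reductions
transport:

* `wreathHW_ne_bot_iff_cons` (abstract): for `±1`-characters `χ` of `S_n ≀ S_m` and `χ'` of
  `S_n ≀ S_{m+1}` with `χ'(liftH τ) = χ(τ)` and `χ'` odd on the transpositions inside the blocks,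
  `wreathHW k M χ μ ≠ ⊥ ↔ wreathHW k (M+1) χ' (n, μ) ≠ ⊥` (`(n, μ) = Fin.cons n μ`: the new greatest
  letter `0` with multiplicity `n`, i.e. a row of width `n` prepended);
* `wreathHW_innerSignChar_ne_bot_iff_cons` (concrete): with `innerSignChar n m false = s` and
  `innerSignChar n m true = s·σₒ` — the characters cutting out `Λⁿ Λᵐ`/`Symⁿ Λᵐ` according to the
  parity of `m` (`WreathHighestWeight.lean`) — prepending flips the Boolean:
  `wreathHW (innerSignChar n m b) μ ≠ ⊥ ↔ wreathHW (innerSignChar n (m+1) (!b)) (n, μ) ≠ ⊥`.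

**Proof** (the printed statement is quoted from [MM15]; the argument here is the elementary
highest-weight computation). `⇒`: for `x ∈ wreathHW χ μ` put `L x = ∑_v x(v) δ_{ι v}` (`ι` =
`insertWord`, the new letter at a new first place of every block) and `E x = A_{χ'}(L x)` (signed
orbit sum, `WreathOrbitSums.lean`). `E x` is `χ'`-isotypic; `(E x)(ι u) = N₀ · x(u)` with `N₀ ≥ 1` the
number of `τ' ∈ S_n ≀ S_{m+1}` whose inner permutations fix the new place (the other `τ'` move a
letter `0` away from a first place, off the support of `L x`), so `E x ≠ 0`; and for upper
triangular `b ∈ GL_{M+1}` with corner `b'`, `b · δ_{ι v} = ∑_{v'} b₀₀ⁿ b'_{v',v} δ_{ι v'} +` (words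
with the letter `0` twice in a block, killed by `A_{χ'}`), whence
`b · E x = b₀₀ⁿ · b'^{μ} E x = b^{(n,μ)} E x`. `⇐`: for `y ∈ wreathHW χ' (n,μ)` the restriction
`R y (u) = y(ι u)` is `χ`-isotypic (via `liftH`), a highest-weight vector for `GL_M` (via
`b' ↦ 1 ⊕ b'`), and nonzero: a word in the support of `y` has content `(n, μ)` and no repeated letter
in a block, hence exactly one `0` per block, so it is `(ι u) ∘ c` for inner transpositions `c`.

## References

* [FischerIkenmeyer2020] §4, Lemma 1 and Fact 2 (citing L. Manivel, M. Michałek, *Secants of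
  minuscule and cominuscule minimal orbits*, Linear Algebra Appl. 481 (2015)).
-/

noncomputable section

open scoped BigOperators

namespace Literature.RepresentationTheory.GeneralLinear

open Literature.NumberTheory.DiophantineGeometry Literature.Computability.AlgebraicComplexity

section Prepend

variable {k : Type*} [Field k] {M n m : ℕ}

/-! ### `L x`: a function on small words pushed to the inserted words -/

/-- `L x = ∑_v x(v) δ_{ι v}`. [cite: FischerIkenmeyer2020, §4 (Fact 2)] -/
def pushInsert (x : Word M (n * m) → k) : Word (M + 1) (n * (m + 1)) → k :=
  ∑ v, x v • Pi.single (insertWord v) (1 : k)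

/-- `(L x)(ι u) = x(u)`. [folklore] -/
theorem pushInsert_apply_insertWord (x : Word M (n * m) → k) (u : Word M (n * m)) :
    pushInsert x (insertWord u) = x u := by
  simp only [pushInsert, Finset.sum_apply, Pi.smul_apply, smul_eq_mul]
  rw [Finset.sum_eq_single u]
  · rw [Pi.single_eq_same, mul_one]
  · intro v _ hv
    rw [Pi.single_eq_of_ne (fun h => hv (insertWord_injective h).symm), mul_zero]
  · intro h; exact absurd (Finset.mem_univ u) h

/-- `(L x)(w) = 0` off the image of `ι`. [folklore] -/
theorem pushInsert_apply_of_forall_ne (x : Word M (n * m) → k) {w : Word (M + 1) (n * (m + 1))}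
    (hw : ∀ v, insertWord v ≠ w) : pushInsert x w = 0 := by
  simp only [pushInsert, Finset.sum_apply, Pi.smul_apply, smul_eq_mul]
  exact Finset.sum_eq_zero fun v _ => by rw [Pi.single_eq_of_ne (hw v).symm, mul_zero]

/-- `L x` as a sum of basis vectors, read by a linear map. [folklore] -/
theorem map_pushInsert (f : (Word (M + 1) (n * (m + 1)) → k) →ₗ[k] (Word (M + 1) (n * (m + 1)) → k))
    (x : Word M (n * m) → k) : f (pushInsert x) = ∑ v, x v • f (Pi.single (insertWord v) 1) := by
  simp only [pushInsert, map_sum, map_smul]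

/-! ### Evaluating signed orbit sums -/

/-- A `±1`-valued character is inversion invariant: `χ(τ⁻¹) = χ(τ)`. [folklore] -/
theorem char_inv {G : Type*} [Group G] (χ : G →* ℤˣ) (g : G) : χ g⁻¹ = χ g := by
  rw [map_inv]
  exact inv_eq_of_mul_eq_one_right (Int.units_mul_self _)

/-- `(A_χ c)(w) = ∑_τ χ(τ) c(w ∘ τ)`. [folklore] -/
theorem twistedOrbitSum_apply_eq {m' N' : ℕ} (χ : ↥(blockPerms n m') →* ℤˣ) (c : Word N' (n * m') → k)
    (w : Word N' (n * m')) :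
    twistedOrbitSum k χ c w =
      ∑ τ : ↥(blockPerms n m'), (((χ τ : ℤˣ) : ℤ) : k) * c (w ∘ ⇑(τ : Equiv.Perm (Fin (n * m')))) := by
  rw [twistedOrbitSum_apply, Finset.sum_apply, ← Equiv.sum_comp (Equiv.inv ↥(blockPerms n m'))]
  refine Finset.sum_congr rfl fun τ _ => ?_
  rw [Equiv.inv_apply, Pi.smul_apply, smul_eq_mul, wordPerm_apply, inv_inv, char_inv]

variable [NeZero m]

omit [NeZero m] in
/-- The identity has trivial inner permutations. [folklore] -/
theorem innerPerm_one_apply (r : Fin n) (p : Fin (m + 1)) :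
    innerPerm (1 : ↥(blockPerms n (m + 1))) r p = p := by
  rw [innerPerm_apply]
  simp [innerFun]

/-- **`(E x)(ι u) = N₀ · x(u)`** where `N₀ ≥ 1` counts the `τ' ∈ S_n ≀ S_{m+1}` whose inner permutations
fix the new place `0` (the others move a letter `0` to a first place of `(ι u) ∘ τ'`... away from it,
so that `(ι u) ∘ τ'` is not an inserted word). [cite: FischerIkenmeyer2020, §4 (Fact 2)] -/
theorem twistedOrbitSum_pushInsert_apply_insertWord (χ : ↥(blockPerms n m) →* ℤˣ)
    (χ' : ↥(blockPerms n (m + 1)) →* ℤˣ) (hcompat : ∀ τ : ↥(blockPerms n m), χ' (liftH τ) = χ τ)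
    {μ : Weight (Fin M)} {x : Word M (n * m) → k} (hx : x ∈ wreathHW k M χ μ) (u : Word M (n * m)) :
    twistedOrbitSum k χ' (pushInsert x) (insertWord u) =
      ((Finset.univ.filter fun τ' : ↥(blockPerms n (m + 1)) => ∀ r, innerPerm τ' r 0 = 0).card : k) * x u := by
  classical
  rw [twistedOrbitSum_apply_eq, Finset.card_eq_sum_ones, Nat.cast_sum, Finset.sum_mul, Finset.sum_filter]
  refine Finset.sum_congr rfl fun τ' _ => ?_
  by_cases hP : ∀ r, innerPerm τ' r 0 = 0
  · rw [if_pos hP, Nat.cast_one, one_mul]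
    have hτ : τ' = liftH (descH τ') := (liftH_descH hP).symm
    conv_lhs => rw [hτ, insertWord_comp_liftH, pushInsert_apply_insertWord, hcompat,
      apply_comp_of_mem_wreathHW hx]
    rw [← mul_assoc, units_cast_mul_self, one_mul]
  · rw [if_neg hP]
    push Not at hP
    obtain ⟨r, hr⟩ := hP
    rw [pushInsert_apply_of_forall_ne, mul_zero]
    intro v hv
    have h := congrFun hv (finProdFinEquiv (r, 0))
    rw [insertWord_zero, Function.comp_apply, apply_finProdFinEquiv_of_mem τ'.2] at h
    obtain ⟨p, hp⟩ := Fin.exists_succ_eq.mpr hr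
    rw [innerPerm_apply] at hp
    rw [← hp, insertWord_succ] at h
    exact Fin.succ_ne_zero _ h.symm

omit [NeZero m] in
/-- The count `N₀` is positive (the identity qualifies). [folklore] -/
theorem card_filter_innerPerm_fix_pos :
    0 < (Finset.univ.filter fun τ' : ↥(blockPerms n (m + 1)) => ∀ r, innerPerm τ' r 0 = 0).card := by
  classical
  exact Finset.card_pos.mpr ⟨1, Finset.mem_filter.mpr ⟨Finset.mem_univ _, fun r => innerPerm_one_apply r 0⟩⟩

/-! ### `E x` is a highest-weight vector -/

omit [NeZero m] in
/-- For upper triangular `b`, against an inserted word only inserted words or words with a repeated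
`0` in a block occur: `∑_w b_{w, ι v} A_{χ'} δ_w = ∑_{v'} b₀₀ⁿ b'_{v', v} A_{χ'} δ_{ι v'}` when `χ'` is odd
on the transpositions inside the blocks. [cite: FischerIkenmeyer2020, §4 (Fact 2)] -/
theorem sum_tensorPowerMatrix_smul_twistedOrbitSum [CharZero k] (χ' : ↥(blockPerms n (m + 1)) →* ℤˣ)
    (hodd : ∀ (r : Fin n) (p p' : Fin (m + 1)) (h : p ≠ p'),
      χ' ⟨Equiv.swap (finProdFinEquiv (r, p)) (finProdFinEquiv (r, p')),
        swap_mem_blockPerms (by simp)⟩ = -1)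
    {b : GL (Fin (M + 1)) k} (hb : IsUpperTriangular b) (v : Word M (n * m)) :
    ∑ w, tensorPowerMatrix k (M + 1) (n * (m + 1)) (b : Matrix _ _ k) w (insertWord v) •
        twistedOrbitSum k χ' (Pi.single w 1) =
      ∑ v', ((b : Matrix (Fin (M + 1)) (Fin (M + 1)) k) 0 0 ^ n *
          tensorPowerMatrix k M (n * m) (cornerGL b hb : Matrix (Fin M) (Fin M) k) v' v) •
        twistedOrbitSum k χ' (Pi.single (insertWord v') 1) := by
  classical
  have hvan : ∀ w, (∀ v', insertWord v' ≠ w) →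
      tensorPowerMatrix k (M + 1) (n * (m + 1)) (b : Matrix _ _ k) w (insertWord v) •
        twistedOrbitSum k χ' (Pi.single w 1) = 0 := by
    intro w hw
    by_cases hne : tensorPowerMatrix k (M + 1) (n * (m + 1)) (b : Matrix _ _ k) w (insertWord v) = 0
    · rw [hne, zero_smul]
    · obtain ⟨r, p, h0, h1⟩ := two_zeros_of_tensorPowerMatrix_ne_zero hb hne hw
      rw [twistedOrbitSum_single_eq_zero χ' (τ₀ := ⟨Equiv.swap (finProdFinEquiv (r, 0))
        (finProdFinEquiv (r, p.succ)), swap_mem_blockPerms (by simp)⟩) ?_ (hodd r 0 p.succ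
        (Fin.succ_ne_zero p).symm), smul_zero]
      funext q
      exact Equiv.apply_swap_eq_self (h0.trans h1.symm) q
  rw [← Finset.sum_subset (Finset.subset_univ (Finset.univ.image (insertWord (M := M) (n := n) (m := m))))
    (fun w _ hw => hvan w fun v' hv' => hw (Finset.mem_image.mpr ⟨v', Finset.mem_univ _, hv'⟩)),
    Finset.sum_image fun v₁ _ v₂ _ h => insertWord_injective h]
  refine Finset.sum_congr rfl fun v' _ => ?_
  rw [tensorPowerMatrix_insertWord_cornerGL b hb]

omit [NeZero m] in
/-- **`E x` is a highest-weight vector of weight `(n, μ)`** (and `χ'`-isotypic): the vector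
`A_{χ'}(L x)` lies in `wreathHW k (M+1) χ' (Fin.cons n μ)` for `x ∈ wreathHW k M χ μ`.
[cite: FischerIkenmeyer2020, §4 (Fact 2)] -/
theorem twistedOrbitSum_pushInsert_mem_wreathHW [CharZero k] (χ : ↥(blockPerms n m) →* ℤˣ)
    (χ' : ↥(blockPerms n (m + 1)) →* ℤˣ)
    (hodd : ∀ (r : Fin n) (p p' : Fin (m + 1)) (h : p ≠ p'),
      χ' ⟨Equiv.swap (finProdFinEquiv (r, p)) (finProdFinEquiv (r, p')),
        swap_mem_blockPerms (by simp)⟩ = -1)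
    {μ : Weight (Fin M)} {x : Word M (n * m) → k} (hx : x ∈ wreathHW k M χ μ) :
    twistedOrbitSum k χ' (pushInsert x) ∈ wreathHW k (M + 1) χ' (Fin.cons (n : ℤ) μ) := by
  refine ⟨fun b hb => ?_, fun σ => wordPerm_twistedOrbitSum χ' σ _⟩
  set b' := cornerGL b hb with hb'def
  have hb' : IsUpperTriangular b' := isUpperTriangular_cornerGL b hb
  -- expand `b · A (L x) = A (b · L x)`
  rw [← twistedOrbitSum_wordRep, map_pushInsert, map_sum]
  simp_rw [map_smul, wordRep_single_eq_sum, map_sum, map_smul,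
    sum_tensorPowerMatrix_smul_twistedOrbitSum χ' hodd hb, ← hb'def, Finset.smul_sum, smul_smul]
  rw [Finset.sum_comm]
  simp_rw [← Finset.sum_smul]
  -- the coefficient of `A δ_{ι v'}` is `b₀₀ⁿ (b' · x)(v') = b₀₀ⁿ b'^{μ} x(v')`
  have hcoef : ∀ v', (∑ v, x v * ((b : Matrix (Fin (M + 1)) (Fin (M + 1)) k) 0 0 ^ n *
      tensorPowerMatrix k M (n * m) (b' : Matrix (Fin M) (Fin M) k) v' v)) =
      (b : Matrix (Fin (M + 1)) (Fin (M + 1)) k) 0 0 ^ n * (weightChar μ b' * x v') := by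
    intro v'
    have h := congrFun (hx.1 b' hb') v'
    rw [wordRep_apply, Pi.smul_apply, smul_eq_mul] at h
    simp_rw [tensorPowerMatrix_apply]
    rw [← h, Finset.mul_sum]
    refine Finset.sum_congr rfl fun v _ => ?_
    ring
  simp_rw [hcoef]
  rw [map_pushInsert, Finset.smul_sum]
  refine Finset.sum_congr rfl fun v' _ => ?_
  rw [smul_smul, weightChar_cons b hb, zpow_natCast, ← hb'def, mul_assoc]

/-- **`E x ≠ 0` for `x ≠ 0`.** [cite: FischerIkenmeyer2020, §4 (Fact 2)] -/
theorem twistedOrbitSum_pushInsert_ne_zero [CharZero k] (χ : ↥(blockPerms n m) →* ℤˣ)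
    (χ' : ↥(blockPerms n (m + 1)) →* ℤˣ) (hcompat : ∀ τ : ↥(blockPerms n m), χ' (liftH τ) = χ τ)
    {μ : Weight (Fin M)} {x : Word M (n * m) → k} (hx : x ∈ wreathHW k M χ μ) (hx0 : x ≠ 0) :
    twistedOrbitSum k χ' (pushInsert x) ≠ 0 := by
  obtain ⟨u, hu⟩ := Function.ne_iff.mp hx0
  intro h
  have := twistedOrbitSum_pushInsert_apply_insertWord χ χ' hcompat hx u
  rw [h, Pi.zero_apply] at this
  exact mul_ne_zero (Nat.cast_ne_zero.mpr (card_filter_innerPerm_fix_pos (n := n) (m := m)).ne') hu this.symm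

/-! ### The restriction `R y (u) = y(ι u)` -/

/-- `R y = y ∘ ι`. [cite: FischerIkenmeyer2020, §4 (Fact 2)] -/
def restrictInsert (y : Word (M + 1) (n * (m + 1)) → k) : Word M (n * m) → k :=
  fun u => y (insertWord u)

omit [Field k] [NeZero m] in
/-- Unfolding lemma for `R`. [folklore] -/
@[simp]
theorem restrictInsert_apply (y : Word (M + 1) (n * (m + 1)) → k) (u : Word M (n * m)) :
    restrictInsert y u = y (insertWord u) :=
  rfl

omit [NeZero m] in
/-- Blockwise count of a letter: `content_i(w) = ∑_r #{p | w(r,p) = i}`. [folklore] -/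
theorem wordContent_eq_sum_blocks {N' m' : ℕ} (w : Word N' (n * m')) (i : Fin N') :
    wordContent w i = ∑ r : Fin n, (Finset.univ.filter fun p : Fin m' => w (finProdFinEquiv (r, p)) = i).card := by
  rw [wordContent, Finset.card_filter, ← Equiv.sum_comp finProdFinEquiv, Fintype.sum_prod_type]
  refine Finset.sum_congr rfl fun r _ => ?_
  rw [Finset.card_filter]

omit [NeZero m] in
/-- **Support of `χ'`-isotypic highest-weight vectors of weight `(n, μ)`**: a word `w` with `y w ≠ 0`
has exactly one letter `0` in every block (content `n` for the letter `0`, no repetition inside a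
block when `χ'` is odd on inner transpositions), hence `w ∘ c = ι u` for suitable transpositions `c`
inside the blocks. [cite: FischerIkenmeyer2020, §4 (Fact 2)] -/
theorem exists_comp_eq_insertWord [CharZero k] (χ' : ↥(blockPerms n (m + 1)) →* ℤˣ)
    (hodd : ∀ (r : Fin n) (p p' : Fin (m + 1)) (h : p ≠ p'),
      χ' ⟨Equiv.swap (finProdFinEquiv (r, p)) (finProdFinEquiv (r, p')),
        swap_mem_blockPerms (by simp)⟩ = -1)
    {μ : Weight (Fin M)} {y : Word (M + 1) (n * (m + 1)) → k}
    (hy : y ∈ wreathHW k (M + 1) χ' (Fin.cons (n : ℤ) μ)) {w : Word (M + 1) (n * (m + 1))} (hw : y w ≠ 0) :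
    ∃ (c : ↥(blockPerms n (m + 1))) (u : Word M (n * m)),
      w ∘ ⇑(c : Equiv.Perm (Fin (n * (m + 1)))) = insertWord u := by
  classical
  obtain ⟨hcontent, hno⟩ := content_eq_and_no_odd_of_apply_ne_zero hy hw
  -- no block carries the letter `0` twice
  have huniq : ∀ r (p p' : Fin (m + 1)), w (finProdFinEquiv (r, p)) = 0 →
      w (finProdFinEquiv (r, p')) = 0 → p = p' := by
    intro r p p' hp hp'
    by_contra hne
    refine hno ⟨Equiv.swap (finProdFinEquiv (r, p)) (finProdFinEquiv (r, p')),
      swap_mem_blockPerms (by simp)⟩ ?_ (hodd r p p' hne)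
    funext q
    exact Equiv.apply_swap_eq_self (hp.trans hp'.symm) q
  -- every block carries the letter `0` exactly once
  set z : Fin n → ℕ := fun r => (Finset.univ.filter fun p : Fin (m + 1) => w (finProdFinEquiv (r, p)) = 0).card
    with hz
  have hzle : ∀ r, z r ≤ 1 := fun r =>
    Finset.card_le_one.mpr fun p hp p' hp' => huniq r p p' (Finset.mem_filter.mp hp).2 (Finset.mem_filter.mp hp').2
  have hzsum : ∑ r, z r = n := by
    have h0 := hcontent 0
    rw [Fin.cons_zero, Nat.cast_inj, wordContent_eq_sum_blocks] at h0
    exact h0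
  have hz1 : ∀ r, z r = 1 := by
    have hsum1 : ∑ r : Fin n, z r = ∑ _r : Fin n, 1 := by
      rw [hzsum, Finset.sum_const, Finset.card_univ, Fintype.card_fin, smul_eq_mul, mul_one]
    intro r
    exact (Finset.sum_eq_sum_iff_of_le fun r _ => hzle r).mp hsum1 r (Finset.mem_univ r)
  -- the place of the `0` in block `r`
  have hex : ∀ r, ∃ p : Fin (m + 1), w (finProdFinEquiv (r, p)) = 0 := fun r => by
    obtain ⟨p, hp⟩ := Finset.card_eq_one.mp (hz1 r)
    have : p ∈ Finset.univ.filter fun p : Fin (m + 1) => w (finProdFinEquiv (r, p)) = 0 := by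
      rw [hp]; exact Finset.mem_singleton_self p
    exact ⟨p, (Finset.mem_filter.mp this).2⟩
  choose pz hpz using hex
  set c : Equiv.Perm (Fin (n * (m + 1))) := innerBlockPerm n (m + 1) fun r => Equiv.swap 0 (pz r) with hc
  have h0' : ∀ r, (w ∘ ⇑c) (finProdFinEquiv (r, 0)) = 0 := fun r => by
    rw [Function.comp_apply, hc, innerBlockPerm_apply, Equiv.swap_apply_left]
    exact hpz r
  have h1' : ∀ r (p : Fin m), (w ∘ ⇑c) (finProdFinEquiv (r, p.succ)) ≠ 0 := fun r p h => by
    rw [Function.comp_apply, hc, innerBlockPerm_apply] at h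
    have heq := huniq r _ _ h (hpz r)
    -- `swap 0 (pz r) p.succ = pz r` forces `p.succ = 0`
    have h2 := congrArg (Equiv.swap (0 : Fin (m + 1)) (pz r)) heq
    rw [Equiv.swap_apply_self, Equiv.swap_apply_right] at h2
    exact Fin.succ_ne_zero p h2
  obtain ⟨u, hu⟩ := exists_insertWord_eq h0' h1'
  exact ⟨⟨c, innerBlockPerm_mem_blockPerms _⟩, u, hu.symm⟩

/-- **`R y ∈ wreathHW k M χ μ`** for `y ∈ wreathHW k (M+1) χ' (n, μ)`: isotypy through the lift
`liftH`, highest weight through `b' ↦ 1 ⊕ b'`. [cite: FischerIkenmeyer2020, §4 (Fact 2)] -/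
theorem restrictInsert_mem_wreathHW (χ : ↥(blockPerms n m) →* ℤˣ) (χ' : ↥(blockPerms n (m + 1)) →* ℤˣ)
    (hcompat : ∀ τ : ↥(blockPerms n m), χ' (liftH τ) = χ τ) {μ : Weight (Fin M)}
    {y : Word (M + 1) (n * (m + 1)) → k} (hy : y ∈ wreathHW k (M + 1) χ' (Fin.cons (n : ℤ) μ)) :
    restrictInsert y ∈ wreathHW k M χ μ := by
  classical
  refine ⟨fun b' hb' => ?_, fun τ => ?_⟩
  · funext u
    rw [wordRep_apply, Pi.smul_apply, smul_eq_mul, restrictInsert_apply]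
    have h := congrFun (hy.1 (oneSumGL b') (isUpperTriangular_oneSumGL hb')) (insertWord u)
    rw [wordRep_apply, Pi.smul_apply, smul_eq_mul, weightChar_cons_oneSumGL] at h
    rw [← h, coe_oneSumGL]
    symm
    rw [← Finset.sum_subset (Finset.subset_univ (Finset.univ.image (insertWord (M := M) (n := n) (m := m))))
      (fun w _ hw => by
        rw [← tensorPowerMatrix_apply, tensorPowerMatrix_oneSum_eq_zero _ u
          (fun v hv => hw (Finset.mem_image.mpr ⟨v, Finset.mem_univ _, hv⟩)), zero_mul]),
      Finset.sum_image fun v₁ _ v₂ _ h => insertWord_injective h]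
    refine Finset.sum_congr rfl fun v _ => ?_
    rw [← tensorPowerMatrix_apply, tensorPowerMatrix_oneSum_insertWord, tensorPowerMatrix_apply,
      restrictInsert_apply]
  · funext u
    rw [wordPerm_apply, Pi.smul_apply, smul_eq_mul, restrictInsert_apply, restrictInsert_apply,
      ← insertWord_comp_liftH, apply_comp_of_mem_wreathHW hy (liftH τ), hcompat]

omit [NeZero m] in
/-- **`R y ≠ 0` for `y ≠ 0`.** [cite: FischerIkenmeyer2020, §4 (Fact 2)] -/
theorem restrictInsert_ne_zero [CharZero k] (χ' : ↥(blockPerms n (m + 1)) →* ℤˣ)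
    (hodd : ∀ (r : Fin n) (p p' : Fin (m + 1)) (h : p ≠ p'),
      χ' ⟨Equiv.swap (finProdFinEquiv (r, p)) (finProdFinEquiv (r, p')),
        swap_mem_blockPerms (by simp)⟩ = -1)
    {μ : Weight (Fin M)} {y : Word (M + 1) (n * (m + 1)) → k}
    (hy : y ∈ wreathHW k (M + 1) χ' (Fin.cons (n : ℤ) μ)) (hy0 : y ≠ 0) : restrictInsert y ≠ 0 := by
  obtain ⟨w, hw⟩ := Function.ne_iff.mp hy0
  obtain ⟨c, u, hcu⟩ := exists_comp_eq_insertWord χ' hodd hy hw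
  have hval : y (insertWord u) = (((χ' c : ℤˣ) : ℤ) : k) * y w := by
    rw [← hcu, apply_comp_of_mem_wreathHW hy c w]
  intro h0
  have := congrFun h0 u
  rw [restrictInsert_apply, hval, Pi.zero_apply] at this
  exact mul_ne_zero (units_cast_ne_zero _) hw this

/-- **Fischer–Ikenmeyer's Fact 2 in the word model (positivity form, abstract characters).** For
`±1`-characters `χ` of `S_n ≀ S_m` and `χ'` of `S_n ≀ S_{m+1}` such that `χ'(liftH τ) = χ(τ)` and `χ'`
is `-1` on the transpositions inside the blocks, and any weight `μ` of `GL_M`: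
`wreathHW k M χ μ ≠ ⊥ ↔ wreathHW k (M+1) χ' (n, μ) ≠ ⊥` — "the multiplicity of `S^λ V` in
`S^ν Λᵐ V` equals the multiplicity of `S^π V` in `S^ν Λ^{m+1} V`", `π = (n, λ)`, here for the
positivity of the multiplicities and `ν ∈ {(n), (1ⁿ)}`. [cite: FischerIkenmeyer2020, §4 (Fact 2)] -/
theorem wreathHW_ne_bot_iff_cons [CharZero k] (χ : ↥(blockPerms n m) →* ℤˣ)
    (χ' : ↥(blockPerms n (m + 1)) →* ℤˣ) (hcompat : ∀ τ : ↥(blockPerms n m), χ' (liftH τ) = χ τ)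
    (hodd : ∀ (r : Fin n) (p p' : Fin (m + 1)) (h : p ≠ p'),
      χ' ⟨Equiv.swap (finProdFinEquiv (r, p)) (finProdFinEquiv (r, p')),
        swap_mem_blockPerms (by simp)⟩ = -1)
    (μ : Weight (Fin M)) :
    wreathHW k M χ μ ≠ ⊥ ↔ wreathHW k (M + 1) χ' (Fin.cons (n : ℤ) μ) ≠ ⊥ := by
  rw [Submodule.ne_bot_iff, Submodule.ne_bot_iff]
  constructor
  · rintro ⟨x, hx, hx0⟩
    exact ⟨_, twistedOrbitSum_pushInsert_mem_wreathHW χ χ' hodd hx,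
      twistedOrbitSum_pushInsert_ne_zero χ χ' hcompat hx hx0⟩
  · rintro ⟨y, hy, hy0⟩
    exact ⟨_, restrictInsert_mem_wreathHW χ χ' hcompat hy, restrictInsert_ne_zero χ' hodd hy hy0⟩

end Prepend

/-! ### The concrete characters: `s` and `s·σₒ` -/

section Concrete

variable {n m : ℕ} [NeZero m]

/-- **The inner-antisymmetric characters**: `innerSignChar n m false = s` (the restricted sign) and
`innerSignChar n m true = s · σₒ`. For `m` odd these cut out `Λⁿ Λᵐ V` and `Symⁿ Λᵐ V` respectively,
for `m` even the other way round (`WreathHighestWeight.lean`, `restrSign_eq`).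
[cite: FischerIkenmeyer2020, §2 (Fact 1) and §4 (Lemma 1)] -/
def innerSignChar (n m : ℕ) [NeZero m] : Bool → (↥(blockPerms n m) →* ℤˣ)
  | false => restrSign n m
  | true => restrSign n m * outerSign

/-- `innerSignChar n m false = restrSign n m`. [folklore] -/
@[simp]
theorem innerSignChar_false : innerSignChar n m false = restrSign n m := rfl

/-- `innerSignChar n m true = restrSign n m * outerSign`. [folklore] -/
@[simp]
theorem innerSignChar_true : innerSignChar n m true = restrSign n m * outerSign := rfl

/-- `σₒ` is trivial on a transposition inside a block. [folklore] -/
theorem outerSign_swap (r : Fin n) (p p' : Fin m) :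
    outerSign (⟨Equiv.swap (finProdFinEquiv (r, p)) (finProdFinEquiv (r, p')), swap_mem_blockPerms (by simp)⟩ :
      ↥(blockPerms n m)) = 1 := by
  have hbm : blockMap (⟨Equiv.swap (finProdFinEquiv (r, p)) (finProdFinEquiv (r, p')),
      swap_mem_blockPerms (by simp)⟩ : ↥(blockPerms n m)) = 1 := by
    refine Equiv.ext fun r' => ?_
    rw [blockMap_apply, Equiv.Perm.coe_one, id_eq]
    change blockIdx n m (Equiv.swap (finProdFinEquiv (r, p)) (finProdFinEquiv (r, p'))
      (finProdFinEquiv (r', (0 : Fin m)))) = r'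
    by_cases h1 : finProdFinEquiv (r', (0 : Fin m)) = finProdFinEquiv (r, p)
    · rw [h1, Equiv.swap_apply_left, blockIdx_finProdFinEquiv]
      have := finProdFinEquiv.injective h1
      simp only [Prod.mk.injEq] at this
      exact this.1.symm
    · by_cases h2 : finProdFinEquiv (r', (0 : Fin m)) = finProdFinEquiv (r, p')
      · rw [h2, Equiv.swap_apply_right, blockIdx_finProdFinEquiv]
        have := finProdFinEquiv.injective h2
        simp only [Prod.mk.injEq] at this
        exact this.1.symm
      · rw [Equiv.swap_apply_of_ne_of_ne h1 h2, blockIdx_finProdFinEquiv]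
  rw [outerSign_apply, hbm, map_one]

omit [NeZero m] in
/-- `s` is `-1` on a transposition of two distinct places inside a block. [folklore] -/
theorem restrSign_swap (r : Fin n) {p p' : Fin m} (h : p ≠ p') :
    restrSign n m (⟨Equiv.swap (finProdFinEquiv (r, p)) (finProdFinEquiv (r, p')), swap_mem_blockPerms (by simp)⟩ :
      ↥(blockPerms n m)) = -1 := by
  rw [restrSign_apply]
  refine Equiv.Perm.sign_swap fun e => h ?_
  have := finProdFinEquiv.injective e
  simp only [Prod.mk.injEq, true_and] at this
  exact this

/-- The characters `innerSignChar` are `-1` on the transpositions inside the blocks. [folklore] -/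
theorem innerSignChar_swap (b : Bool) (r : Fin n) {p p' : Fin m} (h : p ≠ p') :
    innerSignChar n m b (⟨Equiv.swap (finProdFinEquiv (r, p)) (finProdFinEquiv (r, p')),
      swap_mem_blockPerms (by simp)⟩ : ↥(blockPerms n m)) = -1 := by
  cases b
  · rw [innerSignChar_false, restrSign_swap r h]
  · rw [innerSignChar_true, MonoidHom.mul_apply, restrSign_swap r h, outerSign_swap, mul_one]

/-- **Compatibility with the lift: prepending flips the Boolean**, `innerSignChar n (m+1) (!b) (liftH τ) =
innerSignChar n m b τ` (because `s(liftH τ) = s(τ) σₒ(τ)` and `σₒ² = 1`). [cite: FischerIkenmeyer2020, §4 (Lemma 1)] -/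
theorem innerSignChar_liftH (b : Bool) (τ : ↥(blockPerms n m)) :
    innerSignChar n (m + 1) (!b) (liftH τ) = innerSignChar n m b τ := by
  cases b
  · rw [Bool.not_false, innerSignChar_true, innerSignChar_false, MonoidHom.mul_apply, restrSign_liftH,
      outerSign_liftH, mul_assoc, Int.units_mul_self, mul_one]
  · rw [Bool.not_true, innerSignChar_false, innerSignChar_true, MonoidHom.mul_apply, restrSign_liftH]

/-- **Fischer–Ikenmeyer's Fact 2 / Lemma 1 step in the word model, concrete form**:
`wreathHW k M (innerSignChar n m b) μ ≠ ⊥ ↔ wreathHW k (M+1) (innerSignChar n (m+1) (!b)) (n, μ) ≠ ⊥`;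
e.g. for `m` odd and `b = false`: the `Λⁿ Λᵐ` highest-weight space of weight `μ` is nonzero iff the
`Λⁿ Λ^{m+1}` highest-weight space of weight `(n, μ)` is. [cite: FischerIkenmeyer2020, §4 (Lemma 1, Fact 2)] -/
theorem wreathHW_innerSignChar_ne_bot_iff_cons {k : Type*} [Field k] [CharZero k] {M : ℕ} (b : Bool)
    (μ : Weight (Fin M)) :
    wreathHW k M (innerSignChar n m b) μ ≠ ⊥ ↔
      wreathHW k (M + 1) (innerSignChar n (m + 1) (!b)) (Fin.cons (n : ℤ) μ) ≠ ⊥ :=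
  wreathHW_ne_bot_iff_cons (innerSignChar n m b) (innerSignChar n (m + 1) (!b)) (innerSignChar_liftH b)
    (fun r _ _ h => innerSignChar_swap (!b) r h) μ

end Concrete

end Literature.RepresentationTheory.GeneralLinear
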